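import Summits.HodgeConjecture.HodgeConjecture.Theorems.SixfoldTableXCensusTypeIIRow
import Literature.AlgebraicGeometry.HodgeTheory.TypeIIRankThreePowersHodgeClasses
import HarnessLib

/-!
# TABLE X (dimension 6) — row 5 `g6.II(1)` (simple sixfolds with multiplication by an INDEFINITE QUATERNION ALGEBRA
# OVER `ℚ`, quaternion rank three): the census nodes X2 / X1 DISCHARGED IN THE KERNEL, with domain membership,
# unconditionally (cell `pub-hodgeav-hg6`, req-37 (A) Q2b; eng-4 g4, sequel of L10 / L10b)

HONEST FRAMING. HC, `HC_AV` (stmt-1333), `HC_CM` (stmt-3052) and the rung H2 are NOT proved and do not occur here. The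
census nodes X2 / X1 (`TableX.SixfoldCodimTwoCensus` / `TableX.SixfoldCodimThreeCensus` of `SixfoldTableXCover`) are OURS
(`@[conjecture]`), never asserted. KERNEL ONLY: theorems over existing declarations; no definition, no `sorry`, no named
fact (every input is a THEOREM of the tree); typed ≠ proved.

WHY THIS MODULE (census-node self-audit, axis A7 «a row VERIFIED in the kernel, not by dossier», continued). L10
(`SixfoldTableXCensusSimpleRows`, eng-5 g3) did the simple type-I rows 2 / 3 / 4 and the Murty `m = 1` row 6 and listed
row 5 `g6.II(1)` as NOT COVERED («`m = 3`: modulo the named fact `Murty1988_…` of `Ring2AtlasTypeIIRows`»); the cell's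
decision record (Q2B-DECISION-RECORD v1.8 §7) booked row 5 among the FACT-BOUND floor rows where axis A7 stops. Since
then the Literature lane landed `HodgeTheory/TypeIIRankThreePowersHodgeClasses` (2026-08-28), which PROVES, fact-free,
`Bᵖ(B) = Dᵖ(B) ⊗ ℂ` for every `B` with slots over a SIMPLE abelian variety `A` whose endomorphism algebra is a totally
indefinite quaternion algebra over a totally real field `K` with `dim A = 6[K:ℚ]` (type II, `H¹` of quaternion rank
three: V. K. Murty 1988 Thm. 2 at `m = 3` in the quaternion case = Gordon's survey Thm. 7.2 third case;
Banaszak–Gajda–Krasoń 2006 Cor. 7.19 / Thm. 7.34) — in particular `AbelianVariety.isDivisorGenerated_of_sixfold_typeII_rat`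
for the simple SIXFOLDS of type II(1). Row 5 is therefore no longer fact-bound, and THIS FILE moves it onto axis A7:
* §1 `SimpleRows.exists_mul_ne_mul_of_isQuaternionAlgebra` — a quaternion algebra is not commutative (centre `= K`,
  `[D:K] = 4`; elementary), so a SIMPLE abelian variety with quaternion multiplication is NOT of CM type
  (`SimpleRows.not_isOfCMType_of_isSimple_of_isQuaternionAlgebra`, via L10b `not_isOfCMType_of_isSimple_of_noncomm`);
* §2 any dimension: `SimpleRows.census_of_isIsogenous_powSucc_of_isSimple_isTotallyIndefinite_rankThree` — for `B` simple
  of type II with `H¹` of quaternion rank three over `K` and every `A ∼ B^{N+1}`: X2-at-`A` ∧ X1-at-`A` (divisor summand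
  alone; L8 / L10 entry point `census_of_isIsogenous_of_isDivisorGenerated`);
* §3 TABLE X ROW 5, KERNEL VERDICT on the whole isogeny class, WITH DOMAIN MEMBERSHIP: `SimpleRows.census_row5_typeII_rat`
  — `B` simple, `dim B = 6`, `End⁰(B)` a quaternion algebra over `ℚ` split at infinity (this IS Albert type II(1); no
  membership prose needed beyond the definition) ⟹ every `A ∼ B` satisfies `dim A = 6 ∧ ¬ 𝒞 A` AND X2-at-`A` ∧ X1-at-`A`;
  and the same for everything isogenous to a power `B^{N+1}` (conclusions only; the powers leave dimension 6).
FLOOR REMARK: on row 5 the CONCLUSION of L6 (`HodgeConjectureFor`) is now an unconditional tree theorem BY NAME —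
`hodgeConjectureFor_self_of_sixfold_typeII_rat`, `hodgeConjectureFor_powSucc_of_sixfold_typeII_rat`,
`hodgeConjectureFor_of_isIsogenous_powSucc_of_isSimple_isTotallyIndefinite_rankThree` — nothing is restated. No inhabitant
is exhibited: the tree holds no existence record for a sixfold with quaternionic multiplication (Shimura 1963), and none
is invented here. After this file the rows of TABLE X NOT on axis A7 are exactly: row 1 `g6.I(1)` (Tankeev / Pink named
fact), rows 8 / 10 / 12 (type IV non-Weil, general member), the Weil rows, the K3-partner rows and the CM rows.

All declarations in the sub-namespace `TableX.SimpleRows` (lead g2 DEDUP RULE 2026-08-28T20:17:40Z; import-independent of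
L9). Nothing here is a corollary of `HC_CM`; no hypothesis of the cover is discharged GLOBALLY (X2 / X1 quantify over ALL
off-residue sixfolds and stay `@[conjecture]`); typed ≠ proved.
-/

set_option linter.dupNamespace false

noncomputable section

open CategoryTheory
open Literature.AlgebraicGeometry Literature.AlgebraicGeometry.Motives
open Literature.AlgebraicGeometry.Motives.AbelianVariety (IsIsogenous IsSimple)
open Literature.AlgebraicGeometry.HodgeTheory
open Literature.AlgebraicGeometry.Milne1999
open Literature.AlgebraicTopology.SingularHomology
open Literature.Barriers.HodgeConjecture
open Literature.RingTheory.CentralSimple (IsTotallyIndefinite)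
open Literature.NumberTheory.Automorphic (IsQuaternionAlgebra)
open Summit.HodgeConjecture.HodgeConjecture.Ring2.ClassTargets
open Summit.HodgeConjecture.HodgeConjecture.Ring2.Motiv (ProdCMCell)
open Summit.HodgeConjecture.HodgeConjecture.Ring2.Atlas (IsQuarticFieldTypeIVFourfold)

namespace Summit.HodgeConjecture.HodgeConjecture.TableX.SimpleRows

/-! ## §1 Quaternion multiplication excludes CM type (simple case) -/

section Quaternion

/-- **A quaternion algebra is not commutative**: if every two elements of `D` commuted, the centre of `D` would be all
of `D`; but the centre of a quaternion algebra over `K` is (the image of) `K` (`Algebra.IsCentral`), so `⊥ = ⊤` in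
`Subalgebra K D` and `[D:K] = 1`, contradicting `[D:K] = 4`. Elementary. [cite: VignerasLNM800, Ch. I §1]
[cite: MumfordAV1970, §21 (Albert types II, III)] -/
theorem exists_mul_ne_mul_of_isQuaternionAlgebra (K D : Type*) [Field K] [Ring D] [Algebra K D]
    [IsQuaternionAlgebra K D] : ∃ x y : D, x * y ≠ y * x := by
  by_contra h
  push Not at h
  haveI : IsSimpleRing D := IsQuaternionAlgebra.isSimpleRing' K D
  have htop : (⊤ : Subalgebra K D) ≤ ⊥ := fun x _ ↦
    Algebra.IsCentral.out (Subalgebra.mem_center_iff.mpr fun b ↦ h b x)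
  have h1 : Module.finrank K D = 1 :=
    Subalgebra.bot_eq_top_iff_finrank_eq_one.mp (le_antisymm bot_le htop)
  have h4 : Module.finrank K D = 4 := IsQuaternionAlgebra.finrank_eq_four (K := K) (D := D)
  omega

/-- **A SIMPLE complex abelian variety of positive dimension with QUATERNION MULTIPLICATION (`End⁰(B)` a quaternion
algebra over a field `K`: Albert types II and III) is NOT of CM type** — `End⁰(B)` is not commutative (§1) and L10b's
`not_isOfCMType_of_isSimple_of_noncomm` (Mumford §19 Cor. 2: `dim_ℚ End⁰(B) ∣ 2 dim B`). UNCONDITIONAL.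
[cite: MumfordAV1970, §19 Cor. 2 of Thm. 1 (p. 174) and §21 (Albert types)] [cite: Milne1999, §2 p. 54] -/
theorem not_isOfCMType_of_isSimple_of_isQuaternionAlgebra {B : AbelianVariety ℂ} (K : Type*) [Field K]
    [Algebra K B.endAlgebra] [IsQuaternionAlgebra K B.endAlgebra] (hs : B.IsSimple) (h0 : 0 < B.dim) :
    ¬ IsOfCMType B :=
  not_isOfCMType_of_isSimple_of_noncomm hs h0 (exists_mul_ne_mul_of_isQuaternionAlgebra K B.endAlgebra)

end Quaternion

/-! ## §2 Type II of quaternion rank three over a totally real `K` (any dimension `6[K:ℚ]`): both census conclusions on the isogeny class of every power -/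

section RankThree

variable {K : Type} [Field K] [NumberField K]

/-- **Both census conclusions at every `A` isogenous to a power `B^{N+1}` of a SIMPLE abelian variety `B` of type II with
`H¹` of quaternion rank three** (`End⁰(B)` a quaternion algebra over a totally real number field `K`, split at every
infinite place, `dim B = 6[K:ℚ]`): `B•(B^{N+1}) = D•(B^{N+1}) ⊗ ℂ` is the tree theorem
`AbelianVariety.isDivisorGenerated_powSucc_of_isSimple_isTotallyIndefinite_rankThree` (Murty / Gordon Thm. 7.2, `m = 3`;
B–G–K Cor. 7.19), and `B = D` on a model gives X2 / X1 at everything isogenous (§1 of L10). UNCONDITIONAL; any dimension.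
[cite: Gordon1997, Thm. 7.2 (arXiv:alg-geom/9709030 p. 20)] [cite: BanaszakGajdaKrason2006, Cor. 7.19 and Thm. 7.34]
[cite: vanGeemen1994HodgeAV, §2.4–2.5 and Lemma 3.7] -/
theorem census_of_isIsogenous_powSucc_of_isSimple_isTotallyIndefinite_rankThree {A B : AbelianVariety ℂ}
    [Algebra K B.endAlgebra] [IsScalarTower ℚ K B.endAlgebra] [IsQuaternionAlgebra K B.endAlgebra]
    [NumberField.IsTotallyReal K] (hs : B.IsSimple) (hind : IsTotallyIndefinite K B.endAlgebra)
    (hdim : B.dim = 6 * Module.finrank ℚ K) {N : ℕ} (hAB : IsIsogenous A (B.powSucc N)) :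
    (∀ c : complexBetti A.X (2 * 2), IsRationalClass c → IsOfHodgeType A.dim A.X (2 * 2) 2 2 c →
      c ∈ divisorClassesSpan A.X A.dim 2 ⊔ Submodule.span ℂ {w' : complexBetti A.X (2 * 2) |
        ∃ (C : AbelianVariety ℂ) (g : A.X ⟶ C.X) (w : complexBetti C.X (2 * 2)), C.dim < A.dim ∧
          IsRationalClass w ∧ IsOfHodgeType C.dim C.X (2 * 2) 2 2 w ∧ w' = complexBetti.map g (2 * 2) w}) ∧
    (∀ c : complexBetti A.X (2 * 3), IsRationalClass c → IsOfHodgeType A.dim A.X (2 * 3) 3 3 c →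
      c ∈ divisorClassesSpan A.X A.dim 3 ⊔ Submodule.span ℂ {w' : complexBetti A.X (2 * 3) |
          ∃ (a : complexBetti A.X (2 * 2)) (b : complexBetti A.X (2 * 1)),
            IsRationalClass a ∧ IsOfHodgeType A.dim A.X (2 * 2) 2 2 a ∧ IsRationalClass b ∧
            IsOfHodgeType A.dim A.X (2 * 1) 1 1 b ∧ w' = cupProduct (two_mul_add_two_mul 2 1) a b} ⊔
        Submodule.span ℂ {w' : complexBetti A.X (2 * 3) |
          ∃ (C : AbelianVariety ℂ) (g : A.X ⟶ C.X) (w : complexBetti C.X (2 * 3)), C.dim < A.dim ∧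
            IsRationalClass w ∧ IsOfHodgeType C.dim C.X (2 * 3) 3 3 w ∧ w' = complexBetti.map g (2 * 3) w} ⊔
        Submodule.span ℂ {w' : complexBetti A.X (2 * 3) |
          ∃ (B' : AbelianVariety ℂ) (g : A.X ⟶ B'.X) (d : ℕ) (ψ : B' ⟶ B') (w : complexBetti B'.X (2 * 3)),
            B'.dim = 6 ∧ 0 < d ∧ ψ ≫ ψ = -(d • 𝟙 B') ∧ IsRationalClass w ∧
            IsOfHodgeType B'.dim B'.X (2 * 3) 3 3 w ∧ w ∈ weilClassesOf B' ψ 3 d ∧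
            w' = complexBetti.map g (2 * 3) w}) :=
  census_of_isIsogenous_of_isDivisorGenerated hAB
    (AbelianVariety.isDivisorGenerated_powSucc_of_isSimple_isTotallyIndefinite_rankThree B hs hind hdim N)

/-- **Both census conclusions at every `A` isogenous to `B` itself** (`N = 0` of the previous theorem, through
`AbelianVariety.isDivisorGenerated_of_isSimple_isTotallyIndefinite_rankThree`). UNCONDITIONAL; any dimension `6[K:ℚ]`.
[cite: Gordon1997, Thm. 7.2 (arXiv:alg-geom/9709030 p. 20)] [cite: BanaszakGajdaKrason2006, Cor. 7.19 and Thm. 7.34]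
[cite: vanGeemen1994HodgeAV, Lemma 3.7] -/
theorem census_of_isIsogenous_of_isSimple_isTotallyIndefinite_rankThree {A B : AbelianVariety ℂ}
    [Algebra K B.endAlgebra] [IsScalarTower ℚ K B.endAlgebra] [IsQuaternionAlgebra K B.endAlgebra]
    [NumberField.IsTotallyReal K] (hs : B.IsSimple) (hind : IsTotallyIndefinite K B.endAlgebra)
    (hdim : B.dim = 6 * Module.finrank ℚ K) (hAB : IsIsogenous A B) :
    (∀ c : complexBetti A.X (2 * 2), IsRationalClass c → IsOfHodgeType A.dim A.X (2 * 2) 2 2 c →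
      c ∈ divisorClassesSpan A.X A.dim 2 ⊔ Submodule.span ℂ {w' : complexBetti A.X (2 * 2) |
        ∃ (C : AbelianVariety ℂ) (g : A.X ⟶ C.X) (w : complexBetti C.X (2 * 2)), C.dim < A.dim ∧
          IsRationalClass w ∧ IsOfHodgeType C.dim C.X (2 * 2) 2 2 w ∧ w' = complexBetti.map g (2 * 2) w}) ∧
    (∀ c : complexBetti A.X (2 * 3), IsRationalClass c → IsOfHodgeType A.dim A.X (2 * 3) 3 3 c →
      c ∈ divisorClassesSpan A.X A.dim 3 ⊔ Submodule.span ℂ {w' : complexBetti A.X (2 * 3) |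
          ∃ (a : complexBetti A.X (2 * 2)) (b : complexBetti A.X (2 * 1)),
            IsRationalClass a ∧ IsOfHodgeType A.dim A.X (2 * 2) 2 2 a ∧ IsRationalClass b ∧
            IsOfHodgeType A.dim A.X (2 * 1) 1 1 b ∧ w' = cupProduct (two_mul_add_two_mul 2 1) a b} ⊔
        Submodule.span ℂ {w' : complexBetti A.X (2 * 3) |
          ∃ (C : AbelianVariety ℂ) (g : A.X ⟶ C.X) (w : complexBetti C.X (2 * 3)), C.dim < A.dim ∧
            IsRationalClass w ∧ IsOfHodgeType C.dim C.X (2 * 3) 3 3 w ∧ w' = complexBetti.map g (2 * 3) w} ⊔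
        Submodule.span ℂ {w' : complexBetti A.X (2 * 3) |
          ∃ (B' : AbelianVariety ℂ) (g : A.X ⟶ B'.X) (d : ℕ) (ψ : B' ⟶ B') (w : complexBetti B'.X (2 * 3)),
            B'.dim = 6 ∧ 0 < d ∧ ψ ≫ ψ = -(d • 𝟙 B') ∧ IsRationalClass w ∧
            IsOfHodgeType B'.dim B'.X (2 * 3) 3 3 w ∧ w ∈ weilClassesOf B' ψ 3 d ∧
            w' = complexBetti.map g (2 * 3) w}) :=
  census_of_isIsogenous_of_isDivisorGenerated hAB
    (AbelianVariety.isDivisorGenerated_of_isSimple_isTotallyIndefinite_rankThree B hs hind hdim)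

end RankThree

/-! ## §3 TABLE X row 5 `g6.II(1)`: simple sixfolds with `End⁰` an indefinite quaternion algebra over `ℚ` -/

section RowFive

/-- **TABLE X ROW 5 `g6.II(1)`, KERNEL VERDICT on the whole isogeny class, WITH DOMAIN MEMBERSHIP.** For a SIMPLE
complex abelian sixfold `B` whose endomorphism algebra is a quaternion algebra over `ℚ` split at infinity (Albert type
II(1): `IsQuaternionAlgebra ℚ End⁰(B)`, `IsTotallyIndefinite ℚ End⁰(B)`, `dim B = 6` — quaternion rank three) and every
`A` isogenous to `B`: `dim A = 6` and `A` is OFF the residue class `𝒞` (`B` simple and not of CM type, §1; L7 / L10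
transport) — `A` is in the domain of the census nodes —, AND both census conclusions X2-at-`A`, X1-at-`A` hold (`B = D`
on `B`: the tree theorem `AbelianVariety.isDivisorGenerated_of_sixfold_typeII_rat`; divisor summand alone, L7b transport).
UNCONDITIONAL; no named fact (before 2026-08-28 the row was bound to the fact `Murty1988_…` of `Ring2AtlasTypeIIRows`).
[cite: Gordon1997, Thm. 7.2 (arXiv:alg-geom/9709030 p. 20)] [cite: BanaszakGajdaKrason2006, Cor. 7.19 and Thm. 7.34]
[cite: Murty1988, Thm. 2 (p. 67)] [cite: MoonenZarhin1999LowDim, (1.8) and §5 (5.1)] [cite: vanGeemen1994HodgeAV, Lemma 3.7]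
[cite: MumfordAV1970, §19 Cor. 2 of Thm. 1 (p. 174) and §21 (type II)] -/
theorem census_row5_typeII_rat {A B : AbelianVariety ℂ} [IsQuaternionAlgebra ℚ B.endAlgebra] (hB : B.dim = 6)
    (hs : B.IsSimple) (hind : IsTotallyIndefinite ℚ B.endAlgebra) (hAB : IsIsogenous A B) :
    (A.dim = 6 ∧ ¬ (IsOfCMType A ∨ ProdCMCell IsQuarticFieldTypeIVFourfold (fun Z ↦ Z.dim = 2) A)) ∧
    (∀ c : complexBetti A.X (2 * 2), IsRationalClass c → IsOfHodgeType A.dim A.X (2 * 2) 2 2 c →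
      c ∈ divisorClassesSpan A.X A.dim 2 ⊔ Submodule.span ℂ {w' : complexBetti A.X (2 * 2) |
        ∃ (C : AbelianVariety ℂ) (g : A.X ⟶ C.X) (w : complexBetti C.X (2 * 2)), C.dim < A.dim ∧
          IsRationalClass w ∧ IsOfHodgeType C.dim C.X (2 * 2) 2 2 w ∧ w' = complexBetti.map g (2 * 2) w}) ∧
    (∀ c : complexBetti A.X (2 * 3), IsRationalClass c → IsOfHodgeType A.dim A.X (2 * 3) 3 3 c →
      c ∈ divisorClassesSpan A.X A.dim 3 ⊔ Submodule.span ℂ {w' : complexBetti A.X (2 * 3) |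
          ∃ (a : complexBetti A.X (2 * 2)) (b : complexBetti A.X (2 * 1)),
            IsRationalClass a ∧ IsOfHodgeType A.dim A.X (2 * 2) 2 2 a ∧ IsRationalClass b ∧
            IsOfHodgeType A.dim A.X (2 * 1) 1 1 b ∧ w' = cupProduct (two_mul_add_two_mul 2 1) a b} ⊔
        Submodule.span ℂ {w' : complexBetti A.X (2 * 3) |
          ∃ (C : AbelianVariety ℂ) (g : A.X ⟶ C.X) (w : complexBetti C.X (2 * 3)), C.dim < A.dim ∧
            IsRationalClass w ∧ IsOfHodgeType C.dim C.X (2 * 3) 3 3 w ∧ w' = complexBetti.map g (2 * 3) w} ⊔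
        Submodule.span ℂ {w' : complexBetti A.X (2 * 3) |
          ∃ (B' : AbelianVariety ℂ) (g : A.X ⟶ B'.X) (d : ℕ) (ψ : B' ⟶ B') (w : complexBetti B'.X (2 * 3)),
            B'.dim = 6 ∧ 0 < d ∧ ψ ≫ ψ = -(d • 𝟙 B') ∧ IsRationalClass w ∧
            IsOfHodgeType B'.dim B'.X (2 * 3) 3 3 w ∧ w ∈ weilClassesOf B' ψ 3 d ∧
            w' = complexBetti.map g (2 * 3) w}) :=
  ⟨offResidueSix_of_isIsogenous_of_isSimple_of_not_isOfCMType hAB hB hs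
      (not_isOfCMType_of_isSimple_of_isQuaternionAlgebra ℚ hs (by omega)),
    census_of_isIsogenous_of_isDivisorGenerated hAB
      (AbelianVariety.isDivisorGenerated_of_sixfold_typeII_rat hs hind hB)⟩

/-- **Row 5, all powers (conclusions only)**: for `B` as in `census_row5_typeII_rat` and every `A` isogenous to a power
`B^{N+1}`, both census conclusions X2-at-`A` ∧ X1-at-`A` hold (`B•(B^{N+1}) = D•(B^{N+1}) ⊗ ℂ`, tree theorem
`AbelianVariety.isDivisorGenerated_powSucc_of_sixfold_typeII_rat`); for `N ≥ 1` these `A` have dimension `6(N+1)` and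
lie outside the sixfold nodes' domain — the statement is the per-variety conclusion, recorded for the powers because the
print theorem is about all of them («`Hdg(Aᵏ) = Div(Aᵏ)` for all `k ≥ 1`»). UNCONDITIONAL.
[cite: Gordon1997, Thm. 7.2 (arXiv:alg-geom/9709030 p. 20)] [cite: Murty1988, Thm. 2 (p. 67)]
[cite: vanGeemen1994HodgeAV, Lemma 3.7] -/
theorem census_row5_powSucc_typeII_rat {A B : AbelianVariety ℂ} [IsQuaternionAlgebra ℚ B.endAlgebra]
    (hB : B.dim = 6) (hs : B.IsSimple) (hind : IsTotallyIndefinite ℚ B.endAlgebra) {N : ℕ}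
    (hAB : IsIsogenous A (B.powSucc N)) :
    (∀ c : complexBetti A.X (2 * 2), IsRationalClass c → IsOfHodgeType A.dim A.X (2 * 2) 2 2 c →
      c ∈ divisorClassesSpan A.X A.dim 2 ⊔ Submodule.span ℂ {w' : complexBetti A.X (2 * 2) |
        ∃ (C : AbelianVariety ℂ) (g : A.X ⟶ C.X) (w : complexBetti C.X (2 * 2)), C.dim < A.dim ∧
          IsRationalClass w ∧ IsOfHodgeType C.dim C.X (2 * 2) 2 2 w ∧ w' = complexBetti.map g (2 * 2) w}) ∧
    (∀ c : complexBetti A.X (2 * 3), IsRationalClass c → IsOfHodgeType A.dim A.X (2 * 3) 3 3 c →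
      c ∈ divisorClassesSpan A.X A.dim 3 ⊔ Submodule.span ℂ {w' : complexBetti A.X (2 * 3) |
          ∃ (a : complexBetti A.X (2 * 2)) (b : complexBetti A.X (2 * 1)),
            IsRationalClass a ∧ IsOfHodgeType A.dim A.X (2 * 2) 2 2 a ∧ IsRationalClass b ∧
            IsOfHodgeType A.dim A.X (2 * 1) 1 1 b ∧ w' = cupProduct (two_mul_add_two_mul 2 1) a b} ⊔
        Submodule.span ℂ {w' : complexBetti A.X (2 * 3) |
          ∃ (C : AbelianVariety ℂ) (g : A.X ⟶ C.X) (w : complexBetti C.X (2 * 3)), C.dim < A.dim ∧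
            IsRationalClass w ∧ IsOfHodgeType C.dim C.X (2 * 3) 3 3 w ∧ w' = complexBetti.map g (2 * 3) w} ⊔
        Submodule.span ℂ {w' : complexBetti A.X (2 * 3) |
          ∃ (B' : AbelianVariety ℂ) (g : A.X ⟶ B'.X) (d : ℕ) (ψ : B' ⟶ B') (w : complexBetti B'.X (2 * 3)),
            B'.dim = 6 ∧ 0 < d ∧ ψ ≫ ψ = -(d • 𝟙 B') ∧ IsRationalClass w ∧
            IsOfHodgeType B'.dim B'.X (2 * 3) 3 3 w ∧ w ∈ weilClassesOf B' ψ 3 d ∧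
            w' = complexBetti.map g (2 * 3) w}) :=
  census_of_isIsogenous_of_isDivisorGenerated hAB
    (AbelianVariety.isDivisorGenerated_powSucc_of_sixfold_typeII_rat hs hind hB N)

end RowFive

end Summit.HodgeConjecture.HodgeConjecture.TableX.SimpleRows
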